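import Literature.Analysis.FluidPDE.TypeIAncientMild
import Literature.Analysis.FluidPDE.HyperbolicDSSOrbit
import Mathlib.MeasureTheory.Measure.Lebesgue.EqHaar
import Mathlib.MeasureTheory.Integral.Bochner.Set
import HarnessLib

/-!
# Crux `MustSqueeze` (stmt-NavierStokesRegularity-11610), line `outward-drift-signed-flux`:
# elementary properties of the ball gradient energy `stub_gradEnergyBasic`

In backward similarity variables `U = lerayOrbit u` (`U(s, y) = e^{-s/2} u(-e^{-s}, e^{-s/2} y)`)
the line runs two backward-Grönwall passes against the ball gradient energy
`E(ρ, s) = ∫_{B_ρ(0)} |∇U(s)|²_F` (Frobenius norm of the Jacobian).  This file supplies the three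
elementary properties of `E` consumed by the abstract Grönwall stub:

1. `0 ≤ E(ρ, s)` — the integrand `|∇U(s, y)|²_F` is nonnegative;
2. `s ↦ E(ρ, s)` is continuous for `ρ > 0` — the class is jointly smooth on `t < 0` and the
   similarity map is smooth, so `U` is jointly `C^∞` on all of `ℝ × ℝ³`
   (`contDiff_uncurry_lerayOrbit`); hence `(s, y) ↦ ∇U(s, y)` and the Frobenius density are
   jointly continuous, and a parametric integral of a jointly continuous integrand over the
   compact closed ball (which agrees with the open ball up to the Lebesgue-null sphere) is
   continuous in the parameter;
3. `E(ρ, s) ≤ E(ρ', s)` for `ρ ≤ ρ'` — monotonicity of the set integral of a nonnegative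
   integrable function (`setIntegral_mono_set`), integrability coming from continuity of the
   density on the compact closed ball.
-/

noncomputable section

open MeasureTheory Set Metric Filter

namespace Summit.NavierStokesRegularity.NavierStokesRegularity.Theorems

open Literature.Analysis.FluidPDE

/-- Physical / similarity space `ℝ³`. -/
local notation "ℝ³" => EuclideanSpace ℝ (Fin 3)

-- adapted from Cruxes/MustSqueeze/NegativeNotes-StubGradEnergyBasicAndBits.lean
-- (`Drefute.ballGradEnergy_nonneg`)
/-- **Nonnegativity of the ball gradient energy**: `0 ≤ ∫_{B_ρ(0)} |∇U(s)|²_F`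
(the Frobenius density is pointwise nonnegative). [folklore] -/
theorem mustSqueeze_ballGradEnergy_nonneg (u : ℝ → ℝ³ → ℝ³) (ρ s : ℝ) :
    0 ≤ ∫ y in Metric.ball (0 : ℝ³) ρ, frobeniusNormSq (fderiv ℝ (lerayOrbit u s) y) :=
  setIntegral_nonneg measurableSet_ball fun _ _ => frobeniusNormSq_nonneg _

-- adapted from Cruxes/MustSqueeze/NegativeNotes-StubGradEnergyBasicAndBits.lean
-- (`Drefute.continuous_frobeniusNormSq_fderiv_lerayOrbit_uncurry`)
/-- **Joint continuity of the Frobenius gradient density**: `(s, y) ↦ |∇U(s, y)|²_F` is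
continuous on `ℝ × ℝ³` (the orbit `U` is jointly `C^∞`, so its partial space derivative
`(s, y) ↦ ∇U(s, y)` is jointly `C^∞`, in particular continuous). [folklore] -/
theorem mustSqueeze_continuous_frobeniusNormSq_fderiv_lerayOrbit_uncurry {C : ℝ}
    {u : ℝ → ℝ³ → ℝ³} (hu : IsTypeIAncientMild C u) :
    Continuous fun p : ℝ × ℝ³ => frobeniusNormSq (fderiv ℝ (lerayOrbit u p.1) p.2) := by
  have hU : ContDiff ℝ (⊤ : ℕ∞) (Function.uncurry (lerayOrbit u)) :=
    contDiff_uncurry_lerayOrbit hu.contDiffOn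
  have hU' : ContDiff ℝ (⊤ : ℕ∞)
      (Function.uncurry fun (p : ℝ × ℝ³) (q : ℝ³) => lerayOrbit u p.1 q) := by
    have e : (Function.uncurry fun (p : ℝ × ℝ³) (q : ℝ³) => lerayOrbit u p.1 q) =
        Function.uncurry (lerayOrbit u) ∘ fun r : (ℝ × ℝ³) × ℝ³ => (r.1.1, r.2) := by
      funext r; rfl
    rw [e]
    exact hU.comp ((contDiff_fst.comp contDiff_fst).prodMk contDiff_snd)
  have hD : ContDiff ℝ (⊤ : ℕ∞) fun p : ℝ × ℝ³ => fderiv ℝ (lerayOrbit u p.1) p.2 :=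
    hU'.fderiv (m := (⊤ : ℕ∞)) (n := (⊤ : ℕ∞)) contDiff_snd (by simp)
  have hc : Continuous fun p : ℝ × ℝ³ => fderiv ℝ (lerayOrbit u p.1) p.2 := hD.continuous
  unfold frobeniusNormSq
  exact continuous_finsetSum _ fun i _ => ((hc.clm_apply continuous_const).norm).pow 2

/-- The Frobenius gradient density `y ↦ |∇U(s, y)|²_F` of a slice of the orbit is integrable on
every ball (it is continuous — a slice of the jointly continuous density — hence integrable on
the compact closed ball). [folklore] -/
theorem mustSqueeze_integrableOn_frobeniusNormSq_fderiv_lerayOrbit_ball {C : ℝ}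
    {u : ℝ → ℝ³ → ℝ³} (hu : IsTypeIAncientMild C u) (s ρ : ℝ) :
    IntegrableOn (fun y => frobeniusNormSq (fderiv ℝ (lerayOrbit u s) y))
      (Metric.ball (0 : ℝ³) ρ) := by
  have hc : Continuous fun y : ℝ³ => frobeniusNormSq (fderiv ℝ (lerayOrbit u s) y) :=
    (mustSqueeze_continuous_frobeniusNormSq_fderiv_lerayOrbit_uncurry hu).curry_right (x := s)
  exact (hc.continuousOn.integrableOn_compact (isCompact_closedBall (0 : ℝ³) ρ)).mono_set
    ball_subset_closedBall

-- adapted from Cruxes/MustSqueeze/NegativeNotes-StubGradEnergyBasicAndBits.lean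
-- (`Drefute.ballGradEnergy_mono`)
/-- **Monotonicity of the ball gradient energy in the radius**: for `ρ ≤ ρ'`,
`∫_{B_ρ(0)} |∇U(s)|²_F ≤ ∫_{B_ρ'(0)} |∇U(s)|²_F` (nonnegative integrable integrand,
`B_ρ ⊆ B_ρ'`). [folklore] -/
theorem mustSqueeze_ballGradEnergy_mono {C : ℝ} {u : ℝ → ℝ³ → ℝ³} (hu : IsTypeIAncientMild C u)
    (s : ℝ) {ρ ρ' : ℝ} (hρρ' : ρ ≤ ρ') :
    (∫ y in Metric.ball (0 : ℝ³) ρ, frobeniusNormSq (fderiv ℝ (lerayOrbit u s) y)) ≤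
      ∫ y in Metric.ball (0 : ℝ³) ρ', frobeniusNormSq (fderiv ℝ (lerayOrbit u s) y) :=
  setIntegral_mono_set (mustSqueeze_integrableOn_frobeniusNormSq_fderiv_lerayOrbit_ball hu s ρ')
    (Eventually.of_forall fun _ => frobeniusNormSq_nonneg _)
    (Eventually.of_forall (ball_subset_ball hρρ'))

-- adapted from Cruxes/MustSqueeze/NegativeNotes-StubGradEnergyBasicAndBits.lean
-- (`Drefute.ball_ae_eq_closedBall'`)
/-- An open ball of `ℝ³` and its closure agree up to a Lebesgue-null set (the sphere is
null). [folklore] -/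
theorem mustSqueeze_ball_ae_eq_closedBall (ρ : ℝ) :
    (Metric.ball (0 : ℝ³) ρ : Set ℝ³) =ᵐ[volume] (Metric.closedBall (0 : ℝ³) ρ : Set ℝ³) := by
  rw [← ball_union_sphere]
  exact (union_ae_eq_left_of_ae_eq_empty
    (ae_eq_empty.2 (Measure.addHaar_sphere volume _ _))).symm

-- adapted from Cruxes/MustSqueeze/NegativeNotes-StubGradEnergyBasicAndBits.lean
-- (`Drefute.continuous_ballGradEnergy`)
/-- **Continuity of the ball gradient energy in similarity time**: for every radius `ρ`,
`s ↦ ∫_{B_ρ(0)} |∇U(s)|²_F` is continuous (rewrite the open ball as the compact closed ball up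
to a null set and apply continuity of parametric integrals of jointly continuous integrands over
compact sets). [folklore] -/
theorem mustSqueeze_continuous_ballGradEnergy {C : ℝ} {u : ℝ → ℝ³ → ℝ³}
    (hu : IsTypeIAncientMild C u) (ρ : ℝ) :
    Continuous fun s =>
      ∫ y in Metric.ball (0 : ℝ³) ρ, frobeniusNormSq (fderiv ℝ (lerayOrbit u s) y) := by
  have e : (fun s => ∫ y in Metric.ball (0 : ℝ³) ρ, frobeniusNormSq (fderiv ℝ (lerayOrbit u s) y)) =
      fun s => ∫ y in Metric.closedBall (0 : ℝ³) ρ,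
        frobeniusNormSq (fderiv ℝ (lerayOrbit u s) y) := by
    funext s
    exact setIntegral_congr_set (mustSqueeze_ball_ae_eq_closedBall ρ)
  rw [e]
  exact continuous_parametric_integral_of_continuous
    (f := fun s y => frobeniusNormSq (fderiv ℝ (lerayOrbit u s) y))
    (mustSqueeze_continuous_frobeniusNormSq_fderiv_lerayOrbit_uncurry hu) (isCompact_closedBall _ _)

-- adapted from Cruxes/MustSqueeze/NegativeNotes-StubGradEnergyBasicAndBits.lean
-- (`Drefute.stub_gradEnergyBasic`)
/-- **stub_gradEnergyBasic** — the ball gradient energy `E(ρ, s) = ∫_{B_ρ} |∇U(s)|²_F` of the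
(jointly smooth) orbit: nonnegative, continuous in `s` for `ρ > 0`, monotone in `ρ`. -/
theorem stub_gradEnergyBasic : ∀ (C : ℝ) (u : ℝ → ℝ³ → ℝ³), IsTypeIAncientMild C u →
    (∀ (ρ s : ℝ), 0 < ρ →
      0 ≤ ∫ y in Metric.ball (0 : ℝ³) ρ, frobeniusNormSq (fderiv ℝ (lerayOrbit u s) y)) ∧
    (∀ ρ : ℝ, 0 < ρ →
      Continuous fun s => ∫ y in Metric.ball (0 : ℝ³) ρ, frobeniusNormSq (fderiv ℝ (lerayOrbit u s) y)) ∧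
    (∀ (s ρ ρ' : ℝ), 0 < ρ → ρ ≤ ρ' →
      ∫ y in Metric.ball (0 : ℝ³) ρ, frobeniusNormSq (fderiv ℝ (lerayOrbit u s) y) ≤
        ∫ y in Metric.ball (0 : ℝ³) ρ', frobeniusNormSq (fderiv ℝ (lerayOrbit u s) y)) :=
  fun _C u hu =>
    ⟨fun ρ s _ => mustSqueeze_ballGradEnergy_nonneg u ρ s,
      fun ρ _ => mustSqueeze_continuous_ballGradEnergy hu ρ,
      fun s _ρ _ρ' _ h => mustSqueeze_ballGradEnergy_mono hu s h⟩

end Summit.NavierStokesRegularity.NavierStokesRegularity.Theorems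

end
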